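import Mathlib
import Literature.Probability.LatticeModels.TemperleyLiebConnectivityBasis
import Literature.Probability.LatticeModels.TemperleyLiebSmallLink
import Literature.Probability.Percolation.DiagonalColumnPatterns
import Literature.Probability.Percolation.DiagonalStripGroundStateNC
import HarnessLib

/-!
# The small links on column patterns

Topic `Literature/Probability/Percolation`. The pattern-level versions of IP12's small links `φ_i`
(`Literature/Probability/LatticeModels/TemperleyLiebSmallLink.lean`): `cpInsIso P` (insert an
unflagged singleton site at position `P`) and `cpInsDup j` (duplicate the site `j`, flags pulled back
along `Fin.predAbove j`) on `ColPattern n`, and the fact that the dictionary `cpOf` of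
`DiagonalStripGroundStateNC.lean` intertwines them with `NCState.insIso` / `NCState.insDup`
(`cpOf_insIso` for `P ≠ 0`, `cpOf_insDup`), hence with `phiState` (`cpOf_phiState_even/_odd`). This
is the bookkeeping needed to state IP12's Lemma 3.3 for the cluster transfer matrix `t(w; z⃗)` of
`DiagonalStripTransferInhomogeneous.lean` (whose analytic core is `DiagonalStripTransferFusion.lean`).

## References

* Y. Ikhlef, A. K. Ponsaing, J. Stat. Phys. 149 (2012) 10–36, arXiv:1202.5476, Lemma 3.3.
  [IkhlefPonsaing2012]
-/

namespace Literature.Probability.Percolation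

open Literature.Probability.LatticeModels

/-! ### The small links on column patterns -/

section SmallLinkPatterns

open Literature.Probability.LatticeModels.TemperleyLieb

variable {n : ℕ}

/-- **Insert a singleton site at position `P`** into a column pattern (flags pulled back; the new
site is unflagged). [cite: IkhlefPonsaing2012, Lemma 3.3] -/
def cpInsIso (P : Fin (n + 2)) (Q : ColPattern n) : ColPattern (n + 1) :=
  (SiteRel.insertIso Q.1 P, fun a => decide (∃ a', P.succAbove a' = a ∧ Q.2 a' = true))

/-- **Duplicate the site `j`** of a column pattern (new site `j+1` in the class of `j`, flags pulled
back along `predAbove`). [cite: IkhlefPonsaing2012, Lemma 3.3] -/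
def cpInsDup (j : Fin (n + 1)) (Q : ColPattern n) : ColPattern (n + 1) :=
  (SiteRel.insertDup Q.1 j, fun a => Q.2 (j.predAbove a))

/-- **The dictionary matches duplication**: `cpOf (insDup j s) = cpInsDup j (cpOf s)`.
[cite: IkhlefPonsaing2012, Lemma 3.3] -/
theorem cpOf_insDup (j : Fin (n + 1)) (s : NCState (n + 1)) :
    cpOf (NCState.insDup j s) = cpInsDup j (cpOf s) := by
  refine Prod.ext rfl (funext fun a => ?_)
  show (s.1.insertDup j) 0 a = s.1 0 (j.predAbove a)
  simp only [SiteRel.insertDup, SiteRel.pullback_apply, Fin.predAbove_right_zero]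

/-- **The dictionary matches singleton insertion** (away from the wall site: `P ≠ 0`):
`cpOf (insIso P s) = cpInsIso P (cpOf s)`. [cite: IkhlefPonsaing2012, Lemma 3.3] -/
theorem cpOf_insIso {P : Fin (n + 2)} (hP : P ≠ 0) (s : NCState (n + 1)) :
    cpOf (NCState.insIso P s) = cpInsIso P (cpOf s) := by
  refine Prod.ext rfl (funext fun a => ?_)
  show (s.1.insertIso P) 0 a = decide (∃ a', P.succAbove a' = a ∧ s.1 0 a' = true)
  have h0 : P.succAbove 0 = 0 := Fin.succAbove_ne_zero_zero hP
  by_cases ha : a = P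
  · subst ha
    rw [SiteRel.insertIso_self_right]
    have h1 : decide ((0 : Fin (n + 2)) = a) = false := decide_eq_false (Ne.symm hP)
    rw [h1]; symm
    rw [decide_eq_false_iff_not]
    rintro ⟨a', ha', -⟩
    exact Fin.succAbove_ne a a' ha'
  · obtain ⟨a', rfl⟩ := Fin.exists_succAbove_eq ha
    conv_lhs => rw [← h0, SiteRel.insertIso_succAbove s.2.refl]
    symm
    rw [Bool.eq_iff_iff, decide_eq_true_eq]
    constructor
    · rintro ⟨a'', h, h'⟩
      rw [Fin.succAbove_right_inj] at h
      rw [← h]; exact h'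
    · exact fun h => ⟨a', rfl, h⟩

/-- **The dictionary matches IP12's small link** (even `i = 2b`: singleton at `b ≥ 1`).
[cite: IkhlefPonsaing2012, Lemma 3.3] -/
theorem cpOf_phiState_even {i : ℕ} (hi : 1 ≤ i ∧ i ≤ 2 * (n + 1)) (h : i % 2 = 0) (s : NCState (n + 1)) :
    cpOf (phiState (n + 1) i hi s) = cpInsIso ⟨i / 2, by omega⟩ (cpOf s) := by
  rw [phiState_of_even _ hi h]
  refine cpOf_insIso (fun h0 => ?_) s
  have := congrArg Fin.val h0
  simp at this
  omega

/-- **The dictionary matches IP12's small link** (odd `i = 2j+1`: duplication of site `j`).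
[cite: IkhlefPonsaing2012, Lemma 3.3] -/
theorem cpOf_phiState_odd {i : ℕ} (hi : 1 ≤ i ∧ i ≤ 2 * (n + 1)) (h : i % 2 = 1) (s : NCState (n + 1)) :
    cpOf (phiState (n + 1) i hi s) = cpInsDup ⟨(i - 1) / 2, by omega⟩ (cpOf s) := by
  rw [phiState_of_odd _ hi h]
  exact cpOf_insDup _ s

end SmallLinkPatterns

end Literature.Probability.Percolation
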